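import Summits.QuantumFields.YangMills.Theorems.BalabanUVNodesK0BetaChiRadiusBlindGuarded
import Literature.MathematicalPhysics.QuantumFieldTheory.Balaban1983to89.Node00.Record13Ax

/-!
# K0ᴬ — RADIUS BLINDNESS OF THE RE-CENTRED β OF RECORD `betaOfRecord₁₃Ax` (PTA-2's [Ax-3a] `Node00/Record13Ax`, ✓p797092) MODULO A GUARDED READ SET:
# the [Ax-2] cut-off `χ^{(2.9)}_{k,ax}` reads the radius letter only through the selector `U_{k+1}(εreg; ·)` (as the choice-centred one did), so ✓p797170's χ-generic theorem applies

Cell `pub-ymgap`, width seat `pub-ymgap-dag-n07-w3` (g21; N07 [B11] ∕ K0 junction).  `--kind proof --supports stmt-QuantumFields-20541 --as helper`, COUNT-NEUTRAL (K0ᴬ is not yet an item;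
K0⁷ is its aside-bound predecessor, director-ym №467).  NEW leaf; theorems only — 0 `def`, 0 `sorry`, 0 `instance`, 0 `notation`.  Imports this seat's `…K0BetaChiRadiusBlindGuarded` and PTA-2's
`Node00/Record13Ax` (the re-centred χ-slot `chiβOfRecord₁₃Ax θ := chiFixed29Ax θ.ν θ.ε₂₉` and `betaOfRecord₁₃Ax θ := betaOfRecord₈Tχ (TβOfRecord₁₃) (chiβOfRecord₁₃Ax θ) θ.toStage8Params`).
[I] = [Balaban1987RG1]; [III] = [Balaban1988Convergent].

CONTENT.
* §1 ★ `chiFix29AxOfRecord_congr_of_Uk_eq` ∕ `chiFixed29Ax_congr_of_Uk_eq` — [Ax-2]'s cut-off (2.9) centred at the block-AXIAL critical configuration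
  `V^{(k)}_{ax}(V̄) = axialize (Ū^k(U_{k+1}(εreg; V̄)))` reads its numerics only through the selector `U_{k+1}(ν.εreg; V̄)`: two numerics whose selectors agree at `V̄` give the same cut-off at
  `V` (g19 §4's argument verbatim on the Ax names: `critCfgAxOfRecord_def`, `critCfgOfRecord_def`, `fluctDevAxOfRecord_apply`, `chiFix29AxOfRecord_eq_one_iff ∕ _eq_zero_or_one`).
* §2 ★★★ `betaOfRecord₁₃Ax_radiusBlind_of_readSet_guarded` — for `θ : Stage13Params`, a second numerics `ν′` and background radius `ε′`:
  `betaOfRecord₁₃Ax F N θ = betaOfRecord₈Tχ F N (TβOfRecord₁₃ F N) (chiFixed29Ax F N ν′ θ.ε₂₉) {θ.toStage8Params with εbg := ε′}` under the GUARDED read-set rows on an open domain system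
  `U K k ∋ 1` (guard antitone in the level, eventually true in `K`): (hUχ) the cut-offs' selectors `U_{k+1}(θ.ν.εreg; ·) = U_{k+1}(ν′.εreg; ·)` on `U K (k+1)`, (hbg) the backgrounds' selectors
  `U_{k+1}(θ.εbg; ·) = U_{k+1}(ε′; ·)` there, (hN) collar, (hC) continuity of the transform of the re-centred β-density, (hB) nesting.  = ✓p797170 at `χ := chiFixed29Ax θ.ν θ.ε₂₉`,
  `χ′ := chiFixed29Ax ν′ θ.ε₂₉` with (hχ) from §1.  When the K0ᴬ witness family lands (two members differing in the radius letter only), both sides are its members by `rfl`.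

HONEST FRAMING (binding).  Kernel bookkeeping; NO β estimate; nothing of Bałaban's asserted or discharged; every row a displayed hypothesis; defines nothing; touches no body of record;
K0ᴬ not yet filed ∕ K0⁷ aside-bound — NEITHER closed; N07 NOT discharged; COUNT 8∕28 · K 1∕4 UNMOVED; R4 = the CONDITIONAL finite-𝕋⁴ rung `BalabanLadder.UV` at fixed `ε = L^(−K)` only — NOT
continuum ∕ ℝ⁴ ∕ OS; the Yang–Mills mass gap (Clay) is NOT proved by any of this.  Standard axioms only.
-/

noncomputable section

open MeasureTheory Set Filter
open scoped Matrix.Norms.L2Operator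

namespace Summit.QuantumFields.YangMills.BalabanUVNodes.K0BetaAxRadiusBlindGuarded

open _root_.Topology
open Literature.MathematicalPhysics.QuantumFieldTheory.Balaban1983to89
open Literature.MathematicalPhysics.QuantumFieldTheory.Balaban1983to89.Node00
open Literature.MathematicalPhysics.QuantumFieldTheory.Balaban1983to89.T4Continuum (T4Family)
open B12Eq019ActionBody (integrand)
open Summit.QuantumFields.YangMills.BalabanUVNodes.K0BetaChiRadiusBlindGuarded (betaOfRecord₈Tχ_Tcan_eq_of_readSet_guarded)

/-! ## §1  The re-centred cut-off reads the radius letter only through the selector -/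

section Species

variable {F : T4Family} {N : ℕ} [NeZero N]

/-- ★ **`χ^{(2.9)}_{k,ax}` READS THE RADIUS LETTER ONLY THROUGH THE SELECTOR `U_{k+1}(εreg; V̄)`**: two Stage-7 numerics whose background selectors of record agree at the average of `V`
give the same block-axial critical configuration `V^{(k)}_{ax}(V̄)`, the same axial-centred fluctuation variables and the same value of the re-centred cut-off at `V` — for every threshold `ε₁`.
[cite: Balaban1987RG1, (2.2)–(2.3) p.265, (2.9) p.266 (bookkeeping)] -/
theorem chiFix29AxOfRecord_congr_of_Uk_eq {ν ν' : Stage7Numerics} (ε₁ : ℝ) {K k : ℕ} {V : GaugeField (F.P K) k (Node00.SU N)}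
    (h : Uk F N K (k + 1) ν.εreg ((avOfRecord F N K k).avg V) = Uk F N K (k + 1) ν'.εreg ((avOfRecord F N K k).avg V)) :
    chiFix29AxOfRecord F N ν ε₁ K k V = chiFix29AxOfRecord F N ν' ε₁ K k V := by
  have hc : critCfgAxOfRecord F N ν K k ((avOfRecord F N K k).avg V) = critCfgAxOfRecord F N ν' K k ((avOfRecord F N K k).avg V) := by
    rw [critCfgAxOfRecord_def, critCfgAxOfRecord_def, critCfgOfRecord_def, critCfgOfRecord_def, h]
  have hf : ∀ b, fluctDevAxOfRecord F N ν K k V b = fluctDevAxOfRecord F N ν' K k V b := fun b => by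
    rw [fluctDevAxOfRecord_apply, fluctDevAxOfRecord_apply, hc]
  have hiff : chiFix29AxOfRecord F N ν ε₁ K k V = 1 ↔ chiFix29AxOfRecord F N ν' ε₁ K k V = 1 := by
    rw [chiFix29AxOfRecord_eq_one_iff, chiFix29AxOfRecord_eq_one_iff]
    exact forall_congr' fun b => by rw [hf b]
  rcases chiFix29AxOfRecord_eq_zero_or_one ν ε₁ K k V with h0 | h1
  · rcases chiFix29AxOfRecord_eq_zero_or_one ν' ε₁ K k V with h0' | h1'
    · rw [h0, h0']
    · exact absurd (h0.symm.trans (hiff.2 h1')) zero_ne_one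
  · rw [h1, hiff.1 h1]

/-- … hence the re-centred β-slot families `chiFixed29Ax` agree at `V` (any coupling history, any threshold). [cite: Balaban1987RG1, (2.9) p.266 (bookkeeping)] -/
theorem chiFixed29Ax_congr_of_Uk_eq {ν ν' : Stage7Numerics} (ε₁ : ℝ) {K k : ℕ} (g : ℕ → ℝ) {V : GaugeField (F.P K) k (Node00.SU N)}
    (h : Uk F N K (k + 1) ν.εreg ((avOfRecord F N K k).avg V) = Uk F N K (k + 1) ν'.εreg ((avOfRecord F N K k).avg V)) :
    chiFixed29Ax F N ν ε₁ K g k V = chiFixed29Ax F N ν' ε₁ K g k V := by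
  rw [chiFixed29Ax_apply, chiFixed29Ax_apply]
  exact chiFix29AxOfRecord_congr_of_Uk_eq ε₁ h

end Species

/-! ## §2  Radius blindness of the re-centred β of record, guarded read set -/

section Beta

variable (F : T4Family) (N : ℕ) [NeZero N]

/-- ★★★ **RADIUS BLINDNESS OF `betaOfRecord₁₃Ax`, GUARDED READ SET.**  For a Stage-13 tuple `θ`, a second numerics `ν′` and background radius `ε′`, on an open domain system `U K k ∋ 1` at the
pairs of a level guard `G` (antitone in the level, eventually true in `K`): if (hUχ) the cut-offs' selectors `U_{k+1}(θ.ν.εreg; W) = U_{k+1}(ν′.εreg; W)` and (hbg) the backgrounds' selectors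
`U_{k+1}(θ.εbg; W) = U_{k+1}(ε′; W)` agree for `W ∈ U K (k+1)`, (hN) a field whose average lies in `U K (k+1)` and at which `χ^{(2.9)}_{k,ax}` is non-zero lies in `U K k`, (hC) the transform of
the re-centred β-density is regular on `U K (k+1)`, (hB) the averaged background of a field of `U K (k+1)` lies in `U K k` — then the re-centred β at `θ` EQUALS def-B's χ-generic β at the cut-off
of `ν′` and the radius `ε′`: `betaOfRecord₁₃Ax F N θ = betaOfRecord₈Tχ F N (TβOfRecord₁₃ F N) (chiFixed29Ax F N ν′ θ.ε₂₉) {θ.toStage8Params with εbg := ε′}`.  CONDITIONAL on the displayed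
rows; NO β estimate; nothing of Bałaban's asserted. [cite: Balaban1987RG1, (1.20)–(1.22) p.264, (1.21) «T^{(j+1)} ↗ Z^d», (1.6) p.261, (0.19) p.255, (0.21) p.256, p.259, (2.3) p.265, (2.9) p.266; Balaban1988Convergent, p.265 (bookkeeping)] -/
theorem betaOfRecord₁₃Ax_radiusBlind_of_readSet_guarded (θ : Stage13Params F N) (ν' : Stage7Numerics) (ε' : ℝ)
    (G : ℕ → ℕ → Prop) (hmono : ∀ K k, G K (k + 1) → G K k) (hev : ∀ k, ∀ᶠ K in atTop, G K k)
    (U : (K k : ℕ) → Set (GaugeField (F.P K) k (Node00.SU N))) (hUo : ∀ K k, G K k → IsOpen (U K k))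
    (hU1 : ∀ K k, G K k → (1 : GaugeField (F.P K) k (Node00.SU N)) ∈ U K k)
    (hUχ : ∀ K k W, k < K → G K (k + 1) → W ∈ U K (k + 1) → Uk F N K (k + 1) θ.ν.εreg W = Uk F N K (k + 1) ν'.εreg W)
    (hbg : ∀ K k W, k < K → G K (k + 1) → W ∈ U K (k + 1) → Uk F N K (k + 1) θ.εbg W = Uk F N K (k + 1) ε' W)
    (hN : ∀ K k V, k < K → G K (k + 1) → (avOfRecord F N K k).avg V ∈ U K (k + 1) → chiFix29AxOfRecord F N θ.ν θ.ε₂₉ K k V ≠ 0 → V ∈ U K k)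
    (hC : ∀ K (g : ℕ → ℝ) k, k < K → G K (k + 1) → U K (k + 1) ⊆ regSetOfRecord F N K k
      (integrand (chiFixed29Ax F N θ.ν θ.ε₂₉ K g k) (gfOfRecord F N K k) (g k) (effActionHT F N (TcanOfRecord F N) (chiFixed29Ax F N θ.ν θ.ε₂₉) K g k)))
    (hB : ∀ K k W, k < K → G K (k + 1) → W ∈ U K (k + 1) → Averaging.iter (avOfRecord F N K) k (Uk F N K (k + 1) θ.εbg W) ∈ U K k) :
    betaOfRecord₁₃Ax F N θ = betaOfRecord₈Tχ F N (TβOfRecord₁₃ F N) (chiFixed29Ax F N ν' θ.ε₂₉) { θ.toStage8Params with εbg := ε' } :=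
  betaOfRecord₈Tχ_Tcan_eq_of_readSet_guarded F N θ.toStage8Params (chiFixed29Ax F N θ.ν θ.ε₂₉) (chiFixed29Ax F N ν' θ.ε₂₉) ε' G hmono hev U hUo hU1
    (fun K g k V hk hG hV => chiFixed29Ax_congr_of_Uk_eq θ.ε₂₉ g (hUχ K k _ hk hG hV))
    (fun K g k V hk hG hV hz => hN K k V hk hG hV (by rwa [chiFixed29Ax_apply] at hz)) hC hbg hB

end Beta

end Summit.QuantumFields.YangMills.BalabanUVNodes.K0BetaAxRadiusBlindGuarded
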